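import Summits.QuantumFields.BalabanUV.Beta.D1BFx.SymBmAbsorbsBm
import Summits.QuantumFields.BalabanUV.Beta.AxialDressingRootedBmDress
import Summits.QuantumFields.BalabanUV.Beta.SymmetrisedDressingDress

/-!
# `BalabanUV.Beta.D1BFx.SymBmAbsorbsBmSlot` — road «BF-x» for binder row D1, junction (J1) after (γ): **THE BOND SLOT TWIN OF `SymBmAbsorbsBm` —
# the road's extra `Πᵀ_bm` slot projection (PART 8∕10's `coProjBmAtK (toSite (r n)) n` inside the (J2) word) is INVISIBLE on a family that is
# already `Π̂ᵀ^{sym}_bm`-dressed: `coProjBmAtK (toSite r) N (coProjSymAtK (toSite rc) N T) = coProjSymAtK (toSite rc) N T` (any two in-block roots).**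

WHY (owner d1-p2 g21, `J1-WORD-LIST.md` §3 row [J2]): at the dressed (III′) literal `S_lit = (JsB12CombShSym …).S = coProjSymAtK ρc n (…)` on the slot
(`SymmetrisedDressingDress.dressSymAt_S`), the END's (J2) binder carries `blk (coProjBmAtK (toSite (r n)) n (SN (n−1) a (S n)))`; this file removes the
`coProjBmAtK` there exactly.  It is the window (transpose) form of `SymBmAbsorbsBm.comp_piKBm_piKSymBm`: §1 the matrix identity
`Σ_{v ∈ cube} Σ_β pmBm ρ N β (q+v) α q · pmSymBm ρc N γ x β (q+v) = pmSymBm ρc N γ x α q` (`Π̂^{sym}_bm (Π_bm δ_{(α,q)}) = Π̂^{sym}_bm δ_{(α,q)}`,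
`SymBmAbsorbsBm.symAxProjBmAt_axProjBmAt` on the window expansion of the row); §2 the window operators on real one-forms
`coProjBmAt ρ N (coProjSymAt ρc N g) = coProjSymAt ρc N g` (finite sums on the doubled window `q + cube (2N)`); §3 the `MKer`-valued bond slot.

HONEST DEPENDENCY (cell records, verbatim): «continuum YM on T⁴ ⇐ BetaPertH ∧ nine spine estimates (0/9 proved); BetaPertH ⇐ (D1) ∧ (D4) ∧
CAP+tail; G-an2-4 gates asym, D1 and NE2/3/4.»  HONEST FRAMING (cell contract, verbatim): «discharging `BetaPertH` makes Bałaban's UV stability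
UNCONDITIONAL — a real constructive-QFT result; it is NOT the continuum limit and NOT the Clay problem.»  THIS MODULE DISCHARGES NOTHING of (K), of D1
or of the wall: [folklore] finite-sum algebra of two projector windows; nothing of Bałaban's asserted.  No definition, no `def … : Prop`, nothing cited,
0 sorry.  0 root-level binders of row D1 discharged; (K) NOT closed; NOT D1, NOT `BetaPertH`, NOT continuum, NOT Clay.

ABSOLUTE RULE (cell charter, verbatim): «No internally-minted statement may enter as a cited fact. Every hypothesis is either kernel-proved in this
package or a verbatim quotation of a PUBLISHED theorem with page reference. The manuscript(s) under audit are NOT citable for their own disputed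
steps — they are the thing under adjudication; programme-internal (2001/route/tribunal) claims are never citable.»
Unit `b2b-balaban-beta-d1-p2` (road owner, gen 21), 2026-08-22.
-/

noncomputable section

namespace Summit.QuantumFields.BalabanUV.Beta.D1BFx.SymBmAbsorbsBmSlot

open Finset
open scoped BigOperators
open Literature.MathematicalPhysics.QuantumFieldTheory
open Literature.MathematicalPhysics.QuantumFieldTheory.Balaban1983to89
open Literature.MathematicalPhysics.QuantumFieldTheory.Balaban1983to89.Beta
open ExpKernelCalculus (MKer)
open AffineAveraging (Form1 Site box toSite)
open OneStepResolventKernel (Fib)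
open Summit.QuantumFields.BalabanUV.Beta.AxialDressingRooted
open Summit.QuantumFields.BalabanUV.Beta.AxialProjectorBlockMean (axProjBmAt)
open Summit.QuantumFields.BalabanUV.Beta.SymmetrisedAxialGaugeBlockMean (symAxProjBmAt)
open Summit.QuantumFields.BalabanUV.Beta.SymmetrisedDressingMatrix (bondIndR pmSymBm window_of_pmSymBm_ne_zero)
open Summit.QuantumFields.BalabanUV.Beta.SymmetrisedDressingLegs (coProjSymAt coProjSymAt_apply)
open Summit.QuantumFields.BalabanUV.Beta.SymmetrisedDressingDress (coProjSymAtK coProjSymAtK_eval)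
open Summit.QuantumFields.BalabanUV.Beta.SymSliceProjectorFixed (symAxProjBmAt_sum_smul eq_sum_window_bondIndR)
open Summit.QuantumFields.BalabanUV.Beta.D1BFx.SymBmAbsorbsBm (symAxProjBmAt_axProjBmAt)

variable {d : ℕ} {N : ℕ} {r rc : Fin (d + 1) → ℕ}

/-! ## §1 The matrix identity: `Π̂^{sym}_bm` of the window expansion of the row `Π_bm δ_{(α,q)}` -/

/-- [folklore] **`Σ_{v ∈ cube} Σ_β pmBm ρ N β (q+v) α q · pmSymBm ρc N γ x β (q+v) = pmSymBm ρc N γ x α q`** (any two in-block roots):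
the row `Π_bm δ_{(α,q)}` is supported on the window `q + cube`, so `Π̂^{sym}_bm (Π_bm δ_{(α,q)})` is this finite combination, and
`Π̂^{sym}_bm ∘ Π_bm = Π̂^{sym}_bm` (`SymBmAbsorbsBm.symAxProjBmAt_axProjBmAt`). -/
theorem sum_pmBm_mul_pmSymBm (hN : 1 ≤ N) (hr : r ∈ box (d + 1) N) (α γ : Fin (d + 1)) (q x : Fin (d + 1) → ℤ) :
    ∑ v ∈ cube (d + 1) N, ∑ β : Fin (d + 1), pmBm (toSite r) N β (q + v) α q * pmSymBm (toSite rc) N γ x β (q + v)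
      = pmSymBm (toSite rc) N γ x α q := by
  classical
  -- the row `Π_bm δ_{(α,q)}` is supported on the window
  have hsupp : ∀ β y, axProjBmAt (toSite r) N (bondIndR α q) β y ≠ 0 → y - q ∈ cube (d + 1) N := fun β y hne =>
    window_of_pmBm_ne_zero hN hr hne
  have hexp := eq_sum_window_bondIndR (N := N) hsupp
  have key : symAxProjBmAt (toSite rc) N (axProjBmAt (toSite r) N (bondIndR α q)) γ x
      = ∑ p ∈ cube (d + 1) N ×ˢ (Finset.univ : Finset (Fin (d + 1))),
          axProjBmAt (toSite r) N (bondIndR α q) p.2 (q + p.1) * symAxProjBmAt (toSite rc) N (bondIndR p.2 (q + p.1)) γ x := by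
    conv_lhs => rw [hexp]
    rw [symAxProjBmAt_sum_smul]
  rw [Finset.sum_product] at key
  rw [symAxProjBmAt_axProjBmAt hN] at key
  -- `pmBm` ∕ `pmSymBm` ARE these projector values (by definition)
  exact key.symm

/-! ## §2 The window operators on real one-forms -/

/-- [folklore] The `Π̂ᵀ^{sym}_bm` window sum may be taken over ANY finite set containing the window `q + cube`. -/
theorem coProjSymAt_eq_sum_of_subset (hN : 1 ≤ N) (hrc : rc ∈ box (d + 1) N) (g : Form1 (d + 1) ℝ) (α : Fin (d + 1))
    (q : Fin (d + 1) → ℤ) {T : Finset (Fin (d + 1) → ℤ)} (hT : ∀ v ∈ cube (d + 1) N, q + v ∈ T) :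
    coProjSymAt (toSite rc) N g α q = ∑ x ∈ T, ∑ γ : Fin (d + 1), pmSymBm (toSite rc) N γ x α q * g γ x := by
  classical
  have hinj : Set.InjOn (fun v : Fin (d + 1) → ℤ => q + v) ↑(cube (d + 1) N) := fun v _ w _ hvw => add_left_cancel hvw
  have hsub : (cube (d + 1) N).image (fun v => q + v) ⊆ T := by
    intro x hx
    obtain ⟨v, hv, rfl⟩ := Finset.mem_image.1 hx
    exact hT v hv
  rw [coProjSymAt_apply, ← Finset.sum_subset hsub, Finset.sum_image hinj]
  · intro x _ hx
    refine Finset.sum_eq_zero fun γ _ => ?_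
    have h0 : pmSymBm (toSite rc) N γ x α q = 0 := by
      by_contra hne
      exact hx (Finset.mem_image.2 ⟨x - q, window_of_pmSymBm_ne_zero hN hrc hne, by abel⟩)
    rw [h0, zero_mul]

/-- [folklore] The doubled window contains every window of a window point: `v, v′ ∈ cube N ⇒ v + v′ ∈ cube (2N)`. -/
theorem add_mem_cube_two_mul {v v' : Fin (d + 1) → ℤ} (hv : v ∈ cube (d + 1) N) (hv' : v' ∈ cube (d + 1) N) :
    v + v' ∈ cube (d + 1) (2 * N) := by
  rw [mem_cube] at hv hv' ⊢
  intro i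
  have h1 := hv i
  have h2 := hv' i
  rw [Pi.add_apply]
  push_cast
  exact (abs_add_le _ _).trans (by linarith)

/-- [folklore] `cube N ⊆ cube (2N)`. -/
theorem mem_cube_two_mul {v : Fin (d + 1) → ℤ} (hv : v ∈ cube (d + 1) N) : v ∈ cube (d + 1) (2 * N) := by
  have h := add_mem_cube_two_mul (N := N) hv (show (0 : Fin (d + 1) → ℤ) ∈ cube (d + 1) N from by
    rw [mem_cube]; intro i; simp)
  rwa [add_zero] at h

/-- [folklore] **`Πᵀ_bm ∘ Π̂ᵀ^{sym}_bm = Π̂ᵀ^{sym}_bm` ON REAL ONE-FORMS** (window operators; any two in-block roots):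
`coProjBmAt (toSite r) N (coProjSymAt (toSite rc) N g) = coProjSymAt (toSite rc) N g`. -/
theorem coProjBmAt_coProjSymAt (hN : 1 ≤ N) (hr : r ∈ box (d + 1) N) (hrc : rc ∈ box (d + 1) N) (g : Form1 (d + 1) ℝ) :
    coProjBmAt (toSite r) N (coProjSymAt (toSite rc) N g) = coProjSymAt (toSite rc) N g := by
  classical
  funext α q
  -- the doubled window around `q`
  set T : Finset (Fin (d + 1) → ℤ) := (cube (d + 1) (2 * N)).image (fun w => q + w)
  have hTq : ∀ v ∈ cube (d + 1) N, q + v ∈ T := fun v hv => Finset.mem_image.2 ⟨v, mem_cube_two_mul hv, rfl⟩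
  have hTqv : ∀ v ∈ cube (d + 1) N, ∀ v' ∈ cube (d + 1) N, (q + v) + v' ∈ T := fun v hv v' hv' =>
    Finset.mem_image.2 ⟨v + v', add_mem_cube_two_mul hv hv', by abel⟩
  -- both sides on the doubled window
  rw [coProjBmAt_apply, coProjSymAt_eq_sum_of_subset hN hrc g α q hTq]
  have hinner : ∀ v ∈ cube (d + 1) N, ∀ β : Fin (d + 1), coProjSymAt (toSite rc) N g β (q + v)
      = ∑ x ∈ T, ∑ γ : Fin (d + 1), pmSymBm (toSite rc) N γ x β (q + v) * g γ x := fun v hv β =>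
    coProjSymAt_eq_sum_of_subset hN hrc g β (q + v) (hTqv v hv)
  rw [Finset.sum_congr rfl fun v hv => Finset.sum_congr rfl fun β _ => by rw [hinner v hv β]]
  -- expand `pmSymBm ρc N γ x α q` by §1 on the right
  have hR : ∑ x ∈ T, ∑ γ : Fin (d + 1), pmSymBm (toSite rc) N γ x α q * g γ x
      = ∑ x ∈ T, ∑ γ : Fin (d + 1), (∑ v ∈ cube (d + 1) N, ∑ β : Fin (d + 1),
          pmBm (toSite r) N β (q + v) α q * pmSymBm (toSite rc) N γ x β (q + v)) * g γ x :=
    Finset.sum_congr rfl fun x _ => Finset.sum_congr rfl fun γ _ => by rw [sum_pmBm_mul_pmSymBm (rc := rc) hN hr α γ q x]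
  rw [hR]
  -- re-associate the finite sums: both sides are `Σ_x Σ_γ Σ_v Σ_β pmBm · pmSymBm · g`
  calc ∑ v ∈ cube (d + 1) N, ∑ β : Fin (d + 1), pmBm (toSite r) N β (q + v) α q *
          ∑ x ∈ T, ∑ γ : Fin (d + 1), pmSymBm (toSite rc) N γ x β (q + v) * g γ x
      = ∑ v ∈ cube (d + 1) N, ∑ β : Fin (d + 1), ∑ x ∈ T, ∑ γ : Fin (d + 1),
          pmBm (toSite r) N β (q + v) α q * pmSymBm (toSite rc) N γ x β (q + v) * g γ x := by
        refine Finset.sum_congr rfl fun v _ => Finset.sum_congr rfl fun β _ => ?_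
        rw [Finset.mul_sum]
        refine Finset.sum_congr rfl fun x _ => ?_
        rw [Finset.mul_sum]
        exact Finset.sum_congr rfl fun γ _ => by ring
    _ = ∑ v ∈ cube (d + 1) N, ∑ x ∈ T, ∑ β : Fin (d + 1), ∑ γ : Fin (d + 1),
          pmBm (toSite r) N β (q + v) α q * pmSymBm (toSite rc) N γ x β (q + v) * g γ x :=
        Finset.sum_congr rfl fun v _ => Finset.sum_comm
    _ = ∑ x ∈ T, ∑ v ∈ cube (d + 1) N, ∑ β : Fin (d + 1), ∑ γ : Fin (d + 1),
          pmBm (toSite r) N β (q + v) α q * pmSymBm (toSite rc) N γ x β (q + v) * g γ x := Finset.sum_comm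
    _ = ∑ x ∈ T, ∑ v ∈ cube (d + 1) N, ∑ γ : Fin (d + 1), ∑ β : Fin (d + 1),
          pmBm (toSite r) N β (q + v) α q * pmSymBm (toSite rc) N γ x β (q + v) * g γ x :=
        Finset.sum_congr rfl fun x _ => Finset.sum_congr rfl fun v _ => Finset.sum_comm
    _ = ∑ x ∈ T, ∑ γ : Fin (d + 1), ∑ v ∈ cube (d + 1) N, ∑ β : Fin (d + 1),
          pmBm (toSite r) N β (q + v) α q * pmSymBm (toSite rc) N γ x β (q + v) * g γ x :=
        Finset.sum_congr rfl fun x _ => Finset.sum_comm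
    _ = ∑ x ∈ T, ∑ γ : Fin (d + 1), (∑ v ∈ cube (d + 1) N, ∑ β : Fin (d + 1),
          pmBm (toSite r) N β (q + v) α q * pmSymBm (toSite rc) N γ x β (q + v)) * g γ x := by
        refine Finset.sum_congr rfl fun x _ => Finset.sum_congr rfl fun γ _ => ?_
        rw [Finset.sum_mul]
        refine Finset.sum_congr rfl fun v _ => ?_
        rw [Finset.sum_mul]

/-! ## §3 The `MKer`-valued bond slot -/

/-- [folklore] **THE ROAD's `Πᵀ_bm` SLOT PROJECTION IS INVISIBLE ON A `Π̂ᵀ^{sym}_bm`-DRESSED STENCIL FAMILY** (any two in-block roots):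
`coProjBmAtK (toSite r) N (coProjSymAtK (toSite rc) N T) = coProjSymAtK (toSite rc) N T`. At the (III′) literal this removes PART 8∕10's
`coProjBmAtK (toSite (r n)) n` from the (J2) word (`J1-WORD-LIST.md` §3 [J2]). -/
theorem coProjBmAtK_coProjSymAtK (hN : 1 ≤ N) (hr : r ∈ box (d + 1) N) (hrc : rc ∈ box (d + 1) N)
    (T : Fin (d + 1) → (Fin (d + 1) → ℤ) → MKer (d + 1) (Fib d)) :
    coProjBmAtK (toSite r) N (coProjSymAtK (toSite rc) N T) = coProjSymAtK (toSite rc) N T := by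
  funext κ u x y a b
  rw [coProjBmAtK_eval, coProjSymAtK_eval]
  have h : (fun κ' u' => coProjSymAtK (toSite rc) N T κ' u' x y a b) = coProjSymAt (toSite rc) N (fun κ' u' => T κ' u' x y a b) := by
    funext κ' u'
    rw [coProjSymAtK_eval]
  rw [h, coProjBmAt_coProjSymAt hN hr hrc]

end Summit.QuantumFields.BalabanUV.Beta.D1BFx.SymBmAbsorbsBmSlot

end
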